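import Mathlib
import Summits.NavierStokesRegularity.NavierStokesRegularity.Theorems.FilamentSkeletonRssStadiumPairAveragingIntegrable
import Summits.NavierStokesRegularity.NavierStokesRegularity.Theorems.FilamentSkeletonRssStadiumSplitProfile
import Summits.NavierStokesRegularity.NavierStokesRegularity.Theorems.FilamentSkeletonRssStadiumChordModulusAffine
import Summits.NavierStokesRegularity.NavierStokesRegularity.Theorems.FilamentSkeletonRssStadiumChordVariance
import Summits.NavierStokesRegularity.NavierStokesRegularity.Theorems.FilamentSkeletonRssStadiumLegProfiles
import Summits.NavierStokesRegularity.NavierStokesRegularity.Theorems.FilamentSkeletonRssStadiumPartnerPiece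

/-!
# Route `FilamentSkeletonRss` · child crux `TangentSkeletonNearStraightL` (stmt-NavierStokesRegularity-23320) · registered line
# `child_tangent_analytic_strip_L` (b0b56c52900dd90a), stub `stub_stripPropagation` — assembly: DESCENT SOURCES OF THE RIGHT CORNER BY THE AVERAGED SECOND-ORDER CHORD BOUND, REDUCED TO ONE NUMBER

Item R1 (continued) of the quarter-width blueprint (evidence `CORNER-QUARTER-BLUEPRINT-leafhand-15-g0.md` v5 on 23320): the tool for the
MIDDLE descent sources (hand's census: `0.32·hs ≲ a ≲ 0.37·hs` on the straight descent of `Theorems.StadiumCornerRightNear`, where neither the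
sup-form short chord nor the two-feet estimate has margin).  It is `Theorems.StadiumHybridChord` at split `θ = 0` (pure second order, NO
tangent-oscillation input — every `Rb`), assembled from the lower bricks with all integrals evaluated: for a target `z = x₀ + iY` of the right
output corner region and a source `ζ = (x₀ + a) + iη` (`0 < a < 3hs/4`, `0 ≤ η ≤ Y`), along the chord from `ζ` to `z` the Cauchy radius is
AFFINE, `d(r) = (3hs/4 − a) + a·r`, the Lipschitz modulus is `G(r) = (2‖s‖/a)·log(1 + κr)` (`κ = a/(3hs/4 − a)`,
`Theorems.StadiumChordModulusAffine`), and the pair average of `(3/2)(G r − G r′)²` is `3·Var G = (12‖s‖²/a²)·(M₂ − M₁²)` with the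
closed forms `M₁ = ((1+κ)log(1+κ) − κ)/κ`, `M₂ = ((1+κ)log²(1+κ) − 2(1+κ)log(1+κ) + 2κ)/κ`.  With `b = Y − η ≤ bs ≤ a`:
  `12(a² + bs²)(M₂ − M₁²)(a² − bs² + 2a·bs) ≤ a²(a² − bs²)  ⟹  0 < Re(Σᵢ (Fᵢ(ζ) − Fᵢ(z))² + κ′·G)`   (`corner_descent_variance_re_pos_of_num`),
monotone reduction in `b` included (`M₂ − M₁² ≥ 0` by Cauchy–Schwarz, `sq_integral_le`).  What remains per descent piece is real arithmetic
in the one variable `κ` (and `bs/a`).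
HONEST FRAMING: bookkeeping for a HYPOTHETICAL filament skeleton on the NEGATIVE side of a MODEL route; the stub `stub_stripPropagation` is NOT
closed by this file; nothing here bears on Navier–Stokes regularity or blow-up.  `--supports stmt-NavierStokesRegularity-23320`.
-/

set_option linter.dupNamespace false

noncomputable section

namespace Summit.NavierStokesRegularity.NavierStokesRegularity.Theorems.StadiumCornerRightDescentVariance

open Set Metric MeasureTheory
open scoped BigOperators
open Summit.NavierStokesRegularity.NavierStokesRegularity.Theorems.StadiumPairAveragingIntegrable
open Summit.NavierStokesRegularity.NavierStokesRegularity.Theorems.StadiumSplitProfile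
open Summit.NavierStokesRegularity.NavierStokesRegularity.Theorems.StadiumChordModulusAffine
open Summit.NavierStokesRegularity.NavierStokesRegularity.Theorems.StadiumChordVariance
open Summit.NavierStokesRegularity.NavierStokesRegularity.Theorems.StadiumLegProfiles
open Summit.NavierStokesRegularity.NavierStokesRegularity.Theorems.StadiumPartnerPiece

/-- **Cauchy–Schwarz on `[0,1]`**: `(∫₀¹ g)² ≤ ∫₀¹ g²` for a continuous `g`. [folklore] -/
theorem sq_integral_le {g : ℝ → ℝ} (hg : Continuous g) :
    (∫ r in (0:ℝ)..1, g r) ^ 2 ≤ ∫ r in (0:ℝ)..1, g r ^ 2 := by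
  set m : ℝ := ∫ r in (0:ℝ)..1, g r with hm
  have i1 : IntervalIntegrable (fun r : ℝ => g r ^ 2) volume (0:ℝ) 1 :=
    (by fun_prop : Continuous fun r : ℝ => g r ^ 2).intervalIntegrable _ _
  have i2 : IntervalIntegrable (fun r : ℝ => 2 * m * g r) volume (0:ℝ) 1 :=
    (by fun_prop : Continuous fun r : ℝ => 2 * m * g r).intervalIntegrable _ _
  have i3 : IntervalIntegrable (fun _ : ℝ => m ^ 2) volume (0:ℝ) 1 := intervalIntegrable_const
  have h0 : 0 ≤ ∫ r in (0:ℝ)..1, (g r - m) ^ 2 :=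
    intervalIntegral.integral_nonneg zero_le_one fun r _ => sq_nonneg _
  have e : (fun r => (g r - m) ^ 2) = fun r => (g r ^ 2 - 2 * m * g r) + m ^ 2 := by
    funext r; ring
  have hexp : ∫ r in (0:ℝ)..1, (g r - m) ^ 2 = ((∫ r in (0:ℝ)..1, g r ^ 2) - 2 * m * m) + m ^ 2 := by
    rw [e, intervalIntegral.integral_add (i1.sub i2) i3, intervalIntegral.integral_sub i1 i2,
      intervalIntegral.integral_const_mul, intervalIntegral.integral_const, ← hm]
    simp
  rw [hexp] at h0
  nlinarith

/-- **Descent sources of the right corner by the averaged second-order chord bound, reduced to one number.**  Stadium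
`S = {|Im| < hs, |Re − cc| < L + hs}`, `F` holomorphic on `S` with `‖F′‖ ≤ 2` and `Σ (F′)ᵢ² = 1`; target `z = x₀ + iY` (`0 ≤ Y < hs/4`,
`cc ≤ x₀ < cc + L + hs/4`, `Y < hs/4`); source `ζ = (x₀ + a) + iη` with `0 < a < 3hs/4`, `0 ≤ η ≤ Y`, `Y − η ≤ bs ≤ a`; `κ = a/(3hs/4 − a)`,
`M₁ = ((1+κ)log(1+κ) − κ)/κ`, `M₂ = ((1+κ)log²(1+κ) − 2(1+κ)log(1+κ) + 2κ)/κ`.  If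
`12(a² + bs²)(M₂ − M₁²)(a² − bs² + 2a·bs) ≤ a²(a² − bs²)` then for `0 < κ′`, `0 < g₀ ≤ Re G`:
`0 < Re(Σᵢ (Fᵢ(ζ) − Fᵢ(z))² + κ′·G)`. [folklore] -/
theorem corner_descent_variance_re_pos_of_num {hs L cc : ℝ} {F : ℂ → (Fin 3 → ℂ)}
    (hF : DifferentiableOn ℂ F {z : ℂ | |z.im| < hs ∧ |z.re - cc| < L + hs})
    (hM : ∀ z ∈ {z : ℂ | |z.im| < hs ∧ |z.re - cc| < L + hs}, ‖deriv F z‖ ≤ 2)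
    (hunit : ∀ w ∈ {z : ℂ | |z.im| < hs ∧ |z.re - cc| < L + hs}, ∑ i, (deriv F w i) ^ 2 = 1)
    (hhs : 0 < hs) {x₀ Y a η bs : ℝ} (hY : Y < hs / 4) (hx₀ : x₀ < cc + L + hs / 4) (hx₀cc : cc ≤ x₀)
    (ha0 : 0 < a) (ha : a < 3 * hs / 4) (hη0 : 0 ≤ η) (hηY : η ≤ Y) (hb : Y - η ≤ bs) (hbs : bs ≤ a)
    (hnum : 12 * (a ^ 2 + bs ^ 2) *
        ((((1 + a / (3 * hs / 4 - a)) * Real.log (1 + a / (3 * hs / 4 - a)) ^ 2 -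
            2 * (1 + a / (3 * hs / 4 - a)) * Real.log (1 + a / (3 * hs / 4 - a)) + 2 * (a / (3 * hs / 4 - a))) /
            (a / (3 * hs / 4 - a))) -
          (((1 + a / (3 * hs / 4 - a)) * Real.log (1 + a / (3 * hs / 4 - a)) - a / (3 * hs / 4 - a)) /
            (a / (3 * hs / 4 - a))) ^ 2) *
        (a ^ 2 - bs ^ 2 + 2 * a * bs) ≤ a ^ 2 * (a ^ 2 - bs ^ 2))
    {κ' g₀ : ℝ} {Gv : ℂ} (hκ : 0 < κ') (hg₀ : 0 < g₀) (hG : g₀ ≤ Gv.re) :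
    0 < ((∑ i, (F (((x₀ + a : ℝ) : ℂ) + (η : ℂ) * Complex.I) i - F ((x₀ : ℂ) + (Y : ℂ) * Complex.I) i) ^ 2) +
      (κ' : ℂ) * Gv).re := by
  set S : Set ℂ := {z : ℂ | |z.im| < hs ∧ |z.re - cc| < L + hs} with hS
  have hSo : IsOpen S := isOpen_stadium hs (L + hs) cc
  set b : ℝ := Y - η with hbdef
  have hb0 : 0 ≤ b := by rw [hbdef]; linarith
  have hba : b ≤ a := hb.trans hbs
  -- source, chord, target
  set zs : ℂ := ((x₀ + a : ℝ) : ℂ) + (η : ℂ) * Complex.I with hzs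
  set s : ℂ := ((-a : ℝ) : ℂ) + (b : ℂ) * Complex.I with hsdef
  have hsre : s.re = -a := by simp [hsdef]
  have hsim : s.im = b := by simp [hsdef]
  have hzsre : zs.re = x₀ + a := by simp [hzs]
  have hzsim : zs.im = η := by simp [hzs]
  have htarget : zs + s = (x₀ : ℂ) + (Y : ℂ) * Complex.I := by
    apply Complex.ext
    · simp [hzs, hsdef]
    · simp [hzs, hsdef, hbdef]
  have hs2re : (s ^ 2).re = a ^ 2 - b ^ 2 := by rw [pow_two, Complex.mul_re, hsre, hsim]; ring
  have hs2im : (s ^ 2).im = -(2 * a * b) := by rw [pow_two, Complex.mul_im, hsre, hsim]; ring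
  have hnorm2 : ‖s‖ ^ 2 = a ^ 2 + b ^ 2 := by rw [Complex.sq_norm, Complex.normSq_apply, hsre, hsim]; ring
  -- the chord points and the Cauchy discs about them lie in `S`
  set d₀ : ℝ := 3 * hs / 4 - a with hd₀
  have hd₀pos : 0 < d₀ := by rw [hd₀]; linarith
  have hchord_re : ∀ r ∈ Icc (0:ℝ) 1, (zs + (r : ℂ) * s).re = x₀ + a - r * a := by
    intro r hr; simp [hzs, hsdef]; ring
  have hchord_im : ∀ r ∈ Icc (0:ℝ) 1, (zs + (r : ℂ) * s).im = η + r * b := by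
    intro r hr; simp [hzs, hsdef]
  have hball : ∀ r ∈ Icc (0:ℝ) 1, closedBall (zs + (r : ℂ) * s) (d₀ + a * r) ⊆ S := by
    intro r hr w hw
    rw [mem_closedBall, dist_eq_norm] at hw
    have him := (Complex.abs_im_le_norm (w - (zs + (r : ℂ) * s))).trans hw
    have hre := (Complex.abs_re_le_norm (w - (zs + (r : ℂ) * s))).trans hw
    rw [Complex.sub_im, hchord_im r hr] at him
    rw [Complex.sub_re, hchord_re r hr] at hre
    have hrb : r * b ≤ b := mul_le_of_le_one_left hb0 hr.2
    have hrb0 : 0 ≤ r * b := mul_nonneg hr.1 hb0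
    have hra : 0 ≤ r * a := mul_nonneg hr.1 ha0.le
    have hra1 : r * a ≤ a := mul_le_of_le_one_left ha0.le hr.2
    have hd₀a : d₀ + a = 3 * hs / 4 := by rw [hd₀]; ring
    refine ⟨?_, ?_⟩
    · have h1 := abs_le.1 him
      rw [abs_lt]
      constructor
      · linarith only [h1.1, hrb0, hη0, hra1, hd₀a, hY, hhs, hra, ha]
      · linarith only [h1.2, hrb, hra, hd₀a, hY, hηY, hbdef, hra1, ha0]
    · have h1 := abs_le.1 hre
      rw [abs_lt]
      constructor
      · linarith only [h1.1, hra1, hra, hd₀a, hx₀, hx₀cc, hhs, ha0]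
      · linarith only [h1.2, hra, hra1, hd₀a, hx₀, hx₀cc]
  have hseg : ∀ r ∈ Icc (0:ℝ) 1, zs + (r : ℂ) * s ∈ S := fun r hr =>
    hball r hr (mem_closedBall_self (by have := mul_nonneg ha0.le hr.1; linarith))
  -- the Lipschitz modulus along the chord (affine radius `d₀ + a r`)
  have hLip0 := fun (r r' : ℝ) (hr : r ∈ Icc (0:ℝ) 1) (hr' : r' ∈ Icc (0:ℝ) 1) =>
    chord_modulus_affine_le (M := 2) hSo hF hM (z := zs) (s := s) (d₀ := d₀) (d₁ := a) ha0.ne' hd₀pos (by linarith) hball hr hr'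
  -- `log(d₀ + a r) − log d₀ = log(1 + κ r)`
  set κ : ℝ := a / d₀ with hκdef
  have hκpos : 0 < κ := div_pos ha0 hd₀pos
  have hlog : ∀ r ∈ Icc (0:ℝ) 1, Real.log (d₀ + a * r) - Real.log d₀ = Real.log (1 + κ * r) := by
    intro r hr
    have h1 : 0 < d₀ + a * r := by have := mul_nonneg ha0.le hr.1; linarith
    rw [← Real.log_div h1.ne' hd₀pos.ne']
    congr 1
    rw [hκdef]; field_simp
  -- the clamped (globally continuous) modulus
  set c : ℝ := ‖s‖ * 2 / a with hcdef
  have hc0 : 0 ≤ c := by rw [hcdef]; positivity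
  set G : ℝ → ℝ := fun r => c * Real.log (1 + κ * max 0 (min r 1)) with hGdef
  have hlin : Continuous fun r : ℝ => 1 + κ * max 0 (min r 1) :=
    continuous_const.add (continuous_const.mul (continuous_clamp 1))
  have hlin_ne : ∀ r : ℝ, 1 + κ * max 0 (min r 1) ≠ 0 := fun r => by
    have := mul_nonneg hκpos.le (clamp_mem zero_le_one r).1
    exact ne_of_gt (by linarith)
  have hlogcl : Continuous fun r : ℝ => Real.log (1 + κ * max 0 (min r 1)) := hlin.log hlin_ne
  have hGc : Continuous G := continuous_const.mul hlogcl
  have hGeq : ∀ r ∈ Icc (0:ℝ) 1, G r = c * Real.log (1 + κ * r) := by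
    intro r hr; simp only [hGdef, clamp_eq hr]
  have hGmono : ∀ r ∈ Icc (0:ℝ) 1, ∀ r' ∈ Icc (0:ℝ) 1, r ≤ r' → G r ≤ G r' := by
    intro r hr r' hr' hrr'
    rw [hGeq r hr, hGeq r' hr']
    have h1 : 0 < 1 + κ * r := by have := mul_nonneg hκpos.le hr.1; linarith only [this]
    have h2 : 1 + κ * r ≤ 1 + κ * r' := by have := mul_le_mul_of_nonneg_left hrr' hκpos.le; linarith only [this]
    exact mul_le_mul_of_nonneg_left (Real.log_le_log h1 h2) hc0
  have hLip : ∀ r ∈ Icc (0:ℝ) 1, ∀ r' ∈ Icc (0:ℝ) 1,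
      ‖deriv F (zs + (r : ℂ) * s) - deriv F (zs + (r' : ℂ) * s)‖ ≤ |G r - G r'| := by
    intro r hr r' hr'
    have h := hLip0 r r' hr hr'
    rw [hGeq r hr, hGeq r' hr', ← hlog r hr, ← hlog r' hr']
    exact h
  -- the pair bound: second order everywhere, capped by the full range
  set a_ : ℝ → (Fin 3 → ℂ) := fun r => deriv F (zs + (r : ℂ) * s) with ha_
  have hpair : ∀ r ∈ Icc (0:ℝ) 1, ∀ r' ∈ Icc (0:ℝ) 1, ‖∑ i, a_ r i * a_ r' i - 1‖ ≤ (3 / 2 : ℝ) * (G r - G r') ^ 2 := by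
    intro r hr r' hr'
    have hb1 := norm_sum_mul_sub_one_le (a_ r) (a_ r') (hunit _ (hseg r hr)) (hunit _ (hseg r' hr'))
    have hL := hLip r hr r' hr'
    have hsq : ‖a_ r - a_ r'‖ ^ 2 ≤ (G r - G r') ^ 2 := by
      have h := pow_le_pow_left₀ (norm_nonneg _) hL 2
      rwa [sq_abs] at h
    exact hb1.trans (mul_le_mul_of_nonneg_left hsq (by norm_num))
  have hcap : ∀ r ∈ Icc (0:ℝ) 1, ∀ r' ∈ Icc (0:ℝ) 1, (G r - G r') ^ 2 ≤ (G 1 - G 0) ^ 2 := by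
    intro r hr r' hr'
    have h0 : (0:ℝ) ∈ Icc (0:ℝ) 1 := ⟨le_rfl, zero_le_one⟩
    have h1 : (1:ℝ) ∈ Icc (0:ℝ) 1 := ⟨zero_le_one, le_rfl⟩
    have hr0 := hGmono 0 h0 r hr hr.1
    have hr1 := hGmono r hr 1 h1 hr.2
    have hr'0 := hGmono 0 h0 r' hr' hr'.1
    have hr'1 := hGmono r' hr' 1 h1 hr'.2
    rw [← sq_abs (G r - G r'), ← sq_abs (G 1 - G 0)]
    apply pow_le_pow_left₀ (abs_nonneg _)
    rw [abs_of_nonneg (by linarith : 0 ≤ G 1 - G 0)]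
    exact abs_le.2 ⟨by linarith, by linarith⟩
  set C : ℝ := (3 / 2 : ℝ) * (G 1 - G 0) ^ 2 with hC
  set φ : ℝ → ℝ → ℝ := fun r r' => if 0 < r ∧ 0 < r' then (3 / 2 : ℝ) * (G r - G r') ^ 2 else C with hφ
  have hφbound : ∀ r ∈ Icc (0:ℝ) 1, ∀ r' ∈ Icc (0:ℝ) 1, (3 / 2 : ℝ) * (G r - G r') ^ 2 ≤ φ r r' := by
    intro r hr r' hr'
    by_cases h : 0 < r ∧ 0 < r'
    · simp only [hφ, if_pos h]; exact le_rfl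
    · simp only [hφ, if_neg h, hC]
      exact mul_le_mul_of_nonneg_left (hcap r hr r' hr') (by norm_num)
  have hpairφ : ∀ r ∈ Icc (0:ℝ) 1, ∀ r' ∈ Icc (0:ℝ) 1, 1 - φ r r' ≤ (∑ i, a_ r i * a_ r' i).re := by
    intro r hr r' hr'
    have hn := (hpair r hr r' hr').trans (hφbound r hr r' hr')
    have h1 := Complex.abs_re_le_norm (∑ i, a_ r i * a_ r' i - 1)
    have h2 := neg_abs_le (∑ i, a_ r i * a_ r' i - 1).re
    rw [Complex.sub_re, Complex.one_re] at h1 h2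
    linarith
  have hpairψ : ∀ r ∈ Icc (0:ℝ) 1, ∀ r' ∈ Icc (0:ℝ) 1, |(∑ i, a_ r i * a_ r' i).im| ≤ φ r r' := by
    intro r hr r' hr'
    have hn := (hpair r hr r' hr').trans (hφbound r hr r' hr')
    have h1 := Complex.abs_im_le_norm (∑ i, a_ r i * a_ r' i - 1)
    rw [Complex.sub_im, Complex.one_im, sub_zero] at h1
    exact h1.trans hn
  obtain ⟨hφi, hΦi, hΦv⟩ := split_double_mean_eq (C := C) (θ := 0) le_rfl zero_le_one hGc
  have hb2 : b ^ 2 ≤ a ^ 2 := pow_le_pow_left₀ hb0 hba 2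
  have hs2 : 0 ≤ (s ^ 2).re := by rw [hs2re]; linarith only [hb2]
  have hmain := chord_sq_re_ge_of_pairwise_integrable hSo hF hseg hφi hΦi hφi hΦi hpairφ hpairψ hs2
  rw [hΦv] at hmain
  -- the variance in closed form: `3(∫G² − (∫G)²) = 3c²(M₂ − M₁²)`
  have hi : ∀ {f : ℝ → ℝ}, Continuous f → IntervalIntegrable f volume (0:ℝ) 1 := fun hf => hf.intervalIntegrable _ _
  have hlogc : ContinuousOn (fun r : ℝ => Real.log (1 + κ * r)) (uIcc (0:ℝ) 1) := by
    rw [uIcc_of_le zero_le_one]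
    refine ContinuousOn.log (continuousOn_const.add (continuousOn_const.mul continuousOn_id)) fun r hr => ?_
    have := mul_nonneg hκpos.le hr.1
    exact ne_of_gt (by simpa using (by linarith : (0:ℝ) < 1 + κ * r))
  have hlogi : IntervalIntegrable (fun r : ℝ => Real.log (1 + κ * r)) volume (0:ℝ) 1 := hlogc.intervalIntegrable
  have hlog2i : IntervalIntegrable (fun r : ℝ => Real.log (1 + κ * r) ^ 2) volume (0:ℝ) 1 := (hlogc.pow 2).intervalIntegrable
  set M₁ : ℝ := ∫ r in (0:ℝ)..1, Real.log (1 + κ * r) with hM₁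
  set M₂ : ℝ := ∫ r in (0:ℝ)..1, Real.log (1 + κ * r) ^ 2 with hM₂
  have hIG : ∫ r in (0:ℝ)..1, G r = c * M₁ := by
    rw [hM₁, ← intervalIntegral.integral_const_mul]
    refine intervalIntegral.integral_congr fun r hr => ?_
    rw [uIcc_of_le zero_le_one] at hr
    exact hGeq r hr
  have hIG2 : ∫ r in (0:ℝ)..1, G r ^ 2 = c ^ 2 * M₂ := by
    rw [hM₂, ← intervalIntegral.integral_const_mul]
    refine intervalIntegral.integral_congr fun r hr => ?_
    rw [uIcc_of_le zero_le_one] at hr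
    simp only [hGeq r hr]; ring
  have hvar0 : M₁ ^ 2 ≤ M₂ := by
    have h := sq_integral_le (g := fun r => Real.log (1 + κ * max 0 (min r 1))) hlogcl
    have e1 : ∫ r in (0:ℝ)..1, Real.log (1 + κ * max 0 (min r 1)) = M₁ := by
      rw [hM₁]; refine intervalIntegral.integral_congr fun r hr => ?_
      rw [uIcc_of_le zero_le_one] at hr; simp only [clamp_eq hr]
    have e2 : ∫ r in (0:ℝ)..1, Real.log (1 + κ * max 0 (min r 1)) ^ 2 = M₂ := by
      rw [hM₂]; refine intervalIntegral.integral_congr fun r hr => ?_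
      rw [uIcc_of_le zero_le_one] at hr; simp only [clamp_eq hr]
    rw [e1, e2] at h; exact h
  -- closed forms of `M₁`, `M₂`
  have hpos1 : ∀ r ∈ Icc (0:ℝ) 1, 0 < 1 + κ * r := fun r hr => by have := mul_nonneg hκpos.le hr.1; linarith
  have hM₁v : M₁ = ((1 + κ) * Real.log (1 + κ) - κ) / κ := by
    rw [hM₁, integral_log_affine (d₀ := 1) (d₁ := κ) (θ := 0) hκpos.ne' zero_le_one hpos1]
    simp only [mul_one, mul_zero, add_zero, Real.log_one]
    field_simp
    ring
  have hM₂v : M₂ = ((1 + κ) * Real.log (1 + κ) ^ 2 - 2 * (1 + κ) * Real.log (1 + κ) + 2 * κ) / κ := by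
    rw [hM₂, integral_log_sq_affine (d₀ := 1) (d₁ := κ) (θ := 0) hκpos.ne' zero_le_one hpos1]
    simp only [mul_one, mul_zero, add_zero, Real.log_one]
    field_simp
    ring
  -- the averaged bound with `V = 3c²(M₂ − M₁²) = 12(a²+b²)(M₂ − M₁²)/a²`
  set W : ℝ := M₂ - M₁ ^ 2 with hW
  have hW0 : 0 ≤ W := by rw [hW]; linarith
  have hVeq : 0 * (2 - 0) * C + 3 * ((1 - 0) * (∫ r in (0:ℝ)..1, G r ^ 2) - (∫ r in (0:ℝ)..1, G r) ^ 2) =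
      12 * (a ^ 2 + b ^ 2) * W / a ^ 2 := by
    rw [hIG, hIG2, hW]
    have hc2 : c ^ 2 = (a ^ 2 + b ^ 2) * 4 / a ^ 2 := by
      rw [hcdef, div_pow, mul_pow, hnorm2]; ring
    rw [mul_pow, hc2]
    field_simp
    ring
  rw [hVeq, hs2re, hs2im, abs_neg, abs_of_nonneg (by positivity : (0:ℝ) ≤ 2 * a * b)] at hmain
  -- monotone reduction `b ↦ bs` of the numeric hypothesis
  have hnumW : 12 * (a ^ 2 + bs ^ 2) * W * (a ^ 2 - bs ^ 2 + 2 * a * bs) ≤ a ^ 2 * (a ^ 2 - bs ^ 2) := by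
    have e : W = (((1 + a / (3 * hs / 4 - a)) * Real.log (1 + a / (3 * hs / 4 - a)) ^ 2 -
            2 * (1 + a / (3 * hs / 4 - a)) * Real.log (1 + a / (3 * hs / 4 - a)) + 2 * (a / (3 * hs / 4 - a))) /
            (a / (3 * hs / 4 - a))) -
          (((1 + a / (3 * hs / 4 - a)) * Real.log (1 + a / (3 * hs / 4 - a)) - a / (3 * hs / 4 - a)) /
            (a / (3 * hs / 4 - a))) ^ 2 := by
      rw [hW, hM₁v, hM₂v]
    rw [e]; exact hnum
  have hnumb : 12 * (a ^ 2 + b ^ 2) * W * (a ^ 2 - b ^ 2 + 2 * a * b) ≤ a ^ 2 * (a ^ 2 - b ^ 2) := by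
    have hbbs : b ^ 2 ≤ bs ^ 2 := pow_le_pow_left₀ hb0 hb 2
    have h1 : a ^ 2 + b ^ 2 ≤ a ^ 2 + bs ^ 2 := by linarith only [hbbs]
    have h2 : a ^ 2 - b ^ 2 + 2 * a * b ≤ a ^ 2 - bs ^ 2 + 2 * a * bs := by
      have e : (a ^ 2 - bs ^ 2 + 2 * a * bs) - (a ^ 2 - b ^ 2 + 2 * a * b) = (bs - b) * (2 * a - bs - b) := by ring
      have key := mul_nonneg (sub_nonneg.2 hb) (show 0 ≤ 2 * a - bs - b by linarith only [hbs, hba])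
      linarith only [key, e]
    have hab : 0 ≤ a * b := mul_nonneg ha0.le hb0
    have h3 : 0 ≤ a ^ 2 - b ^ 2 + 2 * a * b := by linarith only [hb2, hab]
    have h4 : a ^ 2 * (a ^ 2 - bs ^ 2) ≤ a ^ 2 * (a ^ 2 - b ^ 2) :=
      mul_le_mul_of_nonneg_left (by linarith only [hbbs]) (sq_nonneg a)
    have h5 : 0 ≤ 12 * (a ^ 2 + bs ^ 2) * W := mul_nonneg (by positivity) hW0
    calc 12 * (a ^ 2 + b ^ 2) * W * (a ^ 2 - b ^ 2 + 2 * a * b)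
        ≤ 12 * (a ^ 2 + bs ^ 2) * W * (a ^ 2 - bs ^ 2 + 2 * a * bs) := by
          apply mul_le_mul _ h2 h3 h5
          exact mul_le_mul_of_nonneg_right (mul_le_mul_of_nonneg_left h1 (by norm_num)) hW0
      _ ≤ a ^ 2 * (a ^ 2 - bs ^ 2) := hnumW
      _ ≤ a ^ 2 * (a ^ 2 - b ^ 2) := h4
  -- conclude
  have ha2 : 0 < a ^ 2 := by positivity
  have hkey : 0 ≤ (a ^ 2 - b ^ 2) * (1 - 12 * (a ^ 2 + b ^ 2) * W / a ^ 2) -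
      2 * a * b * (12 * (a ^ 2 + b ^ 2) * W / a ^ 2) := by
    have e : (a ^ 2 - b ^ 2) * (1 - 12 * (a ^ 2 + b ^ 2) * W / a ^ 2) - 2 * a * b * (12 * (a ^ 2 + b ^ 2) * W / a ^ 2) =
        (a ^ 2 * (a ^ 2 - b ^ 2) - 12 * (a ^ 2 + b ^ 2) * W * (a ^ 2 - b ^ 2 + 2 * a * b)) / a ^ 2 := by
      field_simp
      ring
    rw [e]
    exact div_nonneg (by linarith) ha2.le
  have hsym : (∑ i, (F (((x₀ + a : ℝ) : ℂ) + (η : ℂ) * Complex.I) i - F ((x₀ : ℂ) + (Y : ℂ) * Complex.I) i) ^ 2) =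
      ∑ i, (F (zs + s) i - F zs i) ^ 2 := by
    rw [htarget]
    exact Finset.sum_congr rfl fun i _ => by ring
  rw [Complex.add_re, hsym]
  have hκG : 0 < ((κ' : ℂ) * Gv).re := by
    rw [Complex.re_ofReal_mul]
    exact mul_pos hκ (lt_of_lt_of_le hg₀ hG)
  linarith only [hmain, hkey, hκG]

end Summit.NavierStokesRegularity.NavierStokesRegularity.Theorems.StadiumCornerRightDescentVariance

end
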